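import Literature.MathematicalPhysics.QuantumFieldTheory.Balaban1983to89.B9PinCarriersKLevelV1
import Literature.MathematicalPhysics.QuantumFieldTheory.Balaban1983to89.B9Thm37Whole

/-!
# `Balaban1983to89.B9Cor35ComparisonsGpC` — [B9] Cor. 3.5 (p. 407) at the Stage-3′(Y) carriers: the three `U = 1` comparisons of the
# [B9] site propagator `G′(1)` and of the kernel `C(1) = (Q′(1)G′²(1)Q′*(1))⁻¹` against NODE 00's readings `Node00.GpU` ∕ `Node00.CinvU` of
# [4]'s `Δ′_a⁻¹` ∕ `(Q′G′²Q′*)⁻¹` (obligations `hGp_e`, `hGp_h1`, `hC` of the N06 knit) — what they SAY, summand by summand, and the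
# hypotheses of printed shape under which they hold, for ANY operator layer

T. Bałaban, *Propagators for lattice gauge theories in a background field*, Commun. Math. Phys. **99** (1985) 389–434
[`Balaban1985BackgroundPropagators`, "B9"]; [4] = T. Bałaban, *Propagators and renormalization transformations for lattice
gauge theories. II*, Commun. Math. Phys. **96** (1984) 223–250 [`Balaban1984PropagatorsII`].

statement-level skeleton of published theorems with citation tags; proofs where landed; nothing here is a claim about the
Yang–Mills mass gap

THE PRINTED LOCUS (p. 407, proof of Corollary 3.5, verbatim): *"For operators with the external gauge field configuration U = 1,
these theorems [Theorems 3.1–3.3] are proved in [4]"*; Thm 3.1 (3.42) p. 397: *"|(G′(U)λ)(x)|, |(∇_UG′(U)λ)(x)|, |(G′(U)∇*_Uλ)(x)|,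
|(Δ_UG′(U)λ)(x)| ≦ B₀[(L^jη)², L^jη, L^jη, 1]e^{−δ₀d(y,y′)}|λ| for x ∈ Δ(y), y ∈ Λ_j, supp λ ⊂ Δ(y′)"*, (3.43) p. 398: *"‖ζ∇_UG′(U)λ‖_β,
‖ζG′(U)∇*_Uλ‖_β ≦ …"*, Thm 3.2 (3.48) p. 398: *"|(Q′(U)G′²(U)Q′*(U))⁻¹(y, y′)| ≦ B₀(L^jη)^{−4}(L^{j′}η)^{−d}e^{−δ₀d(y,y′)}"*; [4] Prop. 2.2
(2.67) p. 234 and Prop. 2.3 (2.86)–(2.87) p. 238 (the `U = 1` statements).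

THE POINT.  The N06 knit at NODE 00's Stage-11 carrier record (`Summit.…N06AtRecord11CB10YZW.b9_main_of_up_view₁₁B10YZW_of_obligations`,
Literature face `B9PinCarriersKLevelV1.b9LeafX_carriersY`) takes the operator layer `ops : ∀ x, OperatorLayerY … x` of the record as a
PARAMETER and displays, among its obligations, the three `U = 1` comparisons of this file's title:
`hGp_e : ∀ x n λ y, (ops x).Gp.e n 1 λ y ≤ (Node00.GpU x.toKIdx).e n λ y`, `hGp_h1 : ∀ x λ b ζ, (ops x).Gp.h1 1 λ b ζ ≤ (Node00.GpU x.toKIdx).h1 λ b ζ`,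
`hC : ∀ x y y′, |(ops x).Cinv.ker 1 y y′| ≤ |(Node00.CinvU x.toKIdx).ker y y′|` — the `Gp`∕`C` fields of the `U = 1` dictionary
`B9FromB6.DictAtOne` (`B9PinGeometryKLevelV1.dictAtOneY`) through which the knit obtains Thms 3.1–3.2 AT `U = 1` from NODE 00's [4] block
(N03) before the Sect.-B step extends them to the class (3.35).  NODE 00 reads [4]'s `G′ = Δ′_a⁻¹` through p21's k-level torus census
in print's units (`Node00.GpU i` = `B6Prop22KLevelTorusCensusEta.gpTP (toKT i)` at the carrier block `β` of the index bond, on the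
SITE summand of the SUM-typed arguments `Node00.KLoc i` = (torus-site functions) ⊕ (fine-bond functions), and `0` on the bond summand;
the Hölder slot `hHTP` on (site argument, site cut-off), `0` else) and [4]'s `(Q′G′²Q′*)⁻¹` through `B6Prop23KLevelTorusCensus.CinvTP`
at the carrier blocks (`Node00.CinvU`).  No instance of the operator layer exists in the tree (the record's `ops` is free; the layer
that constructs `G′(U) = (Δ′_a(U))⁻¹`, `∇_U`, … over the record's lattices is the cell's open L item), so the three binders cannot be
DISCHARGED here.  THIS FILE proves what they REDUCE to, for ANY backgrounds carrier and ANY kernel family ∕ site kernel over the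
member's geometry (the operator layer enters as section variables, `B9Cor35ComparisonsEH`'s pattern), and supplies the forms an
instance meets them by:

* §1 NODE 00's side unfolded at a k-level index `i : KIdx` (`rfl` ∕ cases): `GpU_e_inl` ∕ `GpU_e_inr` ∕ `GpU_h1_inl_inl` ∕ `GpU_h1_inl_inr` ∕
  `GpU_h1_inr` ∕ `CinvU_ker_eq`, and the floors `gp_e_nonneg_T8` ∕ `gpTP_e_nonneg` ∕ `hHTP_nonneg` ∕ `GpU_e_nonneg` ∕ `GpU_h1_nonneg` (T8's
  entries are suprema of absolute values with an empty-block default `0`, hence `≥ 0` — what the OFF-summand and empty-block cases need).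
* §2 THE ON∕OFF-SUMMAND SPLITS at `i`, any `B`, any `Gp : B9.KernelFamily (geo9K i) B`, `C : B9.SiteKernel (geo9K i) B`: `gp_e_le_GpU_iff` (row
  `hGp_e` ⟺ ON: `Gp.e n 1 (.inl f) y ≤ (gpTP (toKT i)).e n f (β y)` ∧ OFF: `Gp.e n 1 (.inr J) y ≤ 0`), `gp_h1_le_GpU_iff` (row `hGp_h1` ⟺ ON on
  (site argument, site cut-off) against `hHTP` ∧ three OFF nulls), `c_abs_le_CinvU_iff` (row `hC` ⟺ against `CinvTP` at the carrier blocks,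
  `Iff.rfl`); the sufficient forms `gp_e_le_GpU_of_eq_of_null` ∕ `gp_h1_le_GpU_of_eq_of_null` ∕ `c_abs_le_CinvU_of_eq(_T8)` («G′(1), C(1) READ
  AS [4]'s objects» ⇒ the rows, with equality ON and null OFF), `gp_e_le_GpU_of_on_off` ∕ `gp_h1_le_GpU_of_on_off`; and the necessity
  `gp_e_nonpos_of_le_GpU_of_isRight` ∕ `gp_h1_nonpos_of_le_GpU_of_isRight` ∕ `gp_h1_nonpos_of_le_GpU_of_cut_isRight` — LOCATED: the
  record's `G′(1)` never reads a bond function or a bond cut-off (entry «G′∇*λ» included: p21 reads λ a site function and takes the sup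
  over the direction μ), so any operator layer meeting `hGp_e`∕`hGp_h1` has NULL bond-summand readings of `G′` at `U = 1`.
* §3 THE CO-READING ROUTE — Cor. 3.5's sentence in the currency the knit chain of record already uses for `(ops x).Gp`
  (`Summit.…N06AtRecord11ObligationsW38`'s `hco_n : B9Thm37GlueCor36.CoRealizes (ops x).Gp n U …` over n06-c's letters `B9Thm37Whole.Ops`):
  `gp_e_le_GpU_of_coRealizes_one` — per entry `n`, IF `Gp.e n 1` is co-realized by a model operator `A` between real function lattices
  (`CoRealizes Gp n B.one bu bv ev A`) AND `A` is DOMINATED AT `U = 1` by [4]'s entry along the block map (`|A (ev (.inl f)) x| ≤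
  (gpTP (toKT i)).e n f (β (bu x))` — «G′(1) acts as [4]'s Δ′_a⁻¹ on the evaluated site profile», pointwise below p21's block supremum) AND
  the evaluation kills bond arguments (`ev (.inr J) = 0`), THEN the `n`-th clause of `hGp_e`; `gp_e_le_GpU_of_coRealizes_ops_one` — the
  four entries at once over an `Ops` record `𝔬` at `U = 1` (model operators `𝔬.Gp 1`, `𝔬.D 1 ∘ 𝔬.Gp 1`, `𝔬.Gp 1 ∘ 𝔬.Dstar 1`, `𝔬.Lap 1 ∘ 𝔬.Gp 1`,
  evaluations `ev` on sites and `evY` on bonds — LITERALLY the `hco0…hco3` of the W38 chain at `U = 1`).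
* §4 FAMILY LEVEL over def-Y's SIGNATURE `ops : ∀ x : MemberY …, OperatorLayerY d ℓ hd hL b₀ b₁ Mstar 𝔸 G x` (instantiates at NODE 00's
  `OpsY N θ₃ M⋆` by unification): ★ `hGp_e_of_eq_of_null`, ★ `hGp_h1_of_eq_of_null`, ★ `hC_of_eq`, `hC_of_eq_T8`, `hGp_e_of_on_off`,
  `hGp_h1_of_on_off`, ★ `hGp_e_of_coRealizes_ops_one` — conclusions LITERALLY the knit binders `hGp_e` ∕ `hGp_h1` ∕ `hC`.

LOCATED, for the operator layer's author (not acted on here).  The comparison is ARGUMENT-WISE and constant-free.  It is met by a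
layer reading `G′(U)`'s quantities on SCALAR-PROFILE arguments (the record's `λ = .inl f` embedded along one isometric line of the fibre,
`f ↦ f·𝟙`), where at `U = 1` nothing is lost ([4]'s operators act diagonally).  It is NOT met in general by the print-strength reading
«sup over all fibre-valued λ dominated pointwise by |f|» (sign cancellations in `Δ′_a⁻¹`'s kernel are not excluded); a layer wanting that
reading needs `B9FromB6.DictAtOne.Gp_e` generalised to «∃ λ̃, |λ̃| ≤ |λ|, supp λ̃ ⊂ Δ(y′), entry(λ) ≤ GpU-entry(λ̃)» (S-sized, consumer side).

HONEST SCOPE.  Bookkeeping on the knit's hypothesis list: rows `hGp_e`∕`hGp_h1`∕`hC` REDUCED to the operator layer's `U = 1`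
identification of its letters with [4]'s (displayed, printed shape); nothing of [B9] or [4] is asserted; no operator is constructed
(no «junk pin»); count-neutral; NOT a node discharge; one finite lattice programme — nothing continuum, nothing about the mass gap.
Cell `pub-ymgap` (HUMAN RULING D-0062), Track A node N06 [B9], N06-ASSIGNMENT v1 rows 1–3 (bundle F1), seat `pub-ymgap-dag-n06-f`, 2026-08-26.
-/

noncomputable section

namespace Literature.MathematicalPhysics.QuantumFieldTheory.Balaban1983to89.B9Cor35ComparisonsGpC

open B6GlobalChartV1 (PV)
open B6Geom246MultiLevelBox (bset)
open B6Ineq2142KLevelV1 (β)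
open B6KLevelCensusIndexV1 (KIdx)
open B6Prop22KLevelTorusCensus (KTIdx)
open B6Prop22KLevelTorusCensusEta (gpTP hHTP hqTP_nonneg nKT_pos gpTP_e)
open B6Prop23KLevelTorusCensus (CinvTP)
open B9GeoNormsKLevelV1 (geo9K)
open B9PinMembersKLevelV1 (MemberY geo9Y bg9Y)
open B9PinCarriersKLevelV1 (OperatorLayerY)
open B9Thm37GlueCor36 (CoRealizes)
open B9Thm37Whole (Ops)
open Node00 (toKT GpU CinvU kGeoU KLoc KCut)

variable {d ℓ : ℕ} {hd : 1 ≤ d + 1} {hL : Odd (ℓ + 1) ∧ 1 < ℓ + 1} {b₀ b₁ : ℝ} {Mstar : ℕ}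

/-! ## §1 NODE 00's readings `GpU`, `CinvU` unfolded, and their floors -/

section T8Floors

variable (j : KTIdx d ℓ)

/-- p21's four (2.67) sup entries of `G′ = Δ′_a⁻¹` in lattice units are `≥ 0` (suprema over a non-empty finite index of absolute values with
the off-block default `0`). [cite: Balaban1984PropagatorsII, Prop. 2.2 (2.67) p.234 (the reading; bookkeeping)] -/
theorem gp_e_nonneg_T8 (n : Fin 4) (f : ↥(j.XB) → ℝ) (s : ↥(bset j.D.toDomains)) : 0 ≤ j.gp.e n f s := by
  fin_cases n
  · change 0 ≤ j.e0 f s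
    exact Real.iSup_nonneg fun _ => by split_ifs <;> first | exact abs_nonneg _ | exact le_rfl
  · change 0 ≤ j.e1 f s
    exact Real.iSup_nonneg fun _ => by split_ifs <;> first | exact abs_nonneg _ | exact le_rfl
  · change 0 ≤ j.e2 f s
    exact Real.iSup_nonneg fun _ => by split_ifs <;> first | exact abs_nonneg _ | exact le_rfl
  · change 0 ≤ j.e3 f s
    exact Real.iSup_nonneg fun _ => by split_ifs <;> first | exact abs_nonneg _ | exact le_rfl

/-- … hence so are the print-unit entries `gpTP` (rescaled by `η^{(2,1,1,0)}`, `η = L^{−k} > 0`).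
[cite: Balaban1984PropagatorsII, Prop. 2.2 (2.67) p.234, (2.1) p.224 («η = L^{−k}»; bookkeeping)] -/
theorem gpTP_e_nonneg (n : Fin 4) (f : ↥(j.XB) → ℝ) (s : ↥(bset j.D.toDomains)) : 0 ≤ (gpTP j).e n f s := by
  rw [gpTP_e]
  exact mul_nonneg (pow_nonneg (inv_nonneg.2 (nKT_pos j).le) _) (gp_e_nonneg_T8 j n f s)

/-- p21's Hölder slot `max_μ max(‖ζ∇^η_μG′λ‖_α, ‖ζG′∇^{η*}_μλ‖_α)` is `≥ 0`. [cite: Balaban1984PropagatorsII, Prop. 2.2 (2.67) p.234 (entries 4, 5; bookkeeping)] -/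
theorem hHTP_nonneg (f : ↥(j.XB) → ℝ) (α : ℝ) (ζ : ↥(j.XB) → ℝ) : 0 ≤ hHTP j f α ζ :=
  Real.iSup_nonneg fun _ => by split_ifs <;> exact hqTP_nonneg j α _

end T8Floors

section NodeReading

variable (i : KIdx d ℓ hd hL b₀ b₁)

/-- NODE 00's reading of the four (3.42)∕(2.67) sup entries of `G′ = Δ′_a⁻¹` ON A SITE ARGUMENT is p21's print-unit entry at the carrier
block of the index bond (`rfl`). [cite: Balaban1984PropagatorsII, Prop. 2.2 (2.67) p.234 (the reading; bookkeeping)] -/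
theorem GpU_e_inl (n : Fin 4) (f : ↥((toKT i).XB) → ℝ) (b : (kGeoU i).Site) :
    (GpU i).e n (Sum.inl f) b = (gpTP (toKT i)).e n f (β i.hN i.D i.hk b) := rfl

/-- NODE 00's reading of the four sup entries of `G′` ON A BOND ARGUMENT is `0` (`rfl`).
[cite: Balaban1984PropagatorsII, Prop. 2.2 (2.67) p.234 (the reading; bookkeeping)] -/
theorem GpU_e_inr (n : Fin 4) (J : PBond (PV d ℓ i.m i.K hd hL) 0 → ℝ) (b : (kGeoU i).Site) :
    (GpU i).e n (Sum.inr J) b = 0 := rfl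

/-- NODE 00's reading vanishes on every argument of the bond summand (`isRight`-form, as the knit phrases summands).
[cite: Balaban1984PropagatorsII, Prop. 2.2 (2.67) p.234 (the reading; bookkeeping)] -/
theorem GpU_e_of_isRight (n : Fin 4) {lam : KLoc i} (h : lam.isRight = true) (b : (kGeoU i).Site) : (GpU i).e n lam b = 0 := by
  cases lam with
  | inl f => exact absurd h (by simp)
  | inr J => rfl

/-- NODE 00's reading of the (3.43)∕(2.67)₄,₅ Hölder slot of `G′` on (site argument, site cut-off) is p21's `hHTP` (`rfl`).
[cite: Balaban1984PropagatorsII, Prop. 2.2 (2.67) p.234 (entries 4, 5; the reading)] -/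
theorem GpU_h1_inl_inl (f : ↥((toKT i).XB) → ℝ) (α : ℝ) (z : ↥((toKT i).XB) → ℝ) :
    (GpU i).h1 (Sum.inl f) α (Sum.inl z) = hHTP (toKT i) f α z := rfl

/-- … on (site argument, bond cut-off) it is `0` (`rfl`). [cite: Balaban1984PropagatorsII, Prop. 2.2 (2.67) p.234 (the reading; bookkeeping)] -/
theorem GpU_h1_inl_inr (f : ↥((toKT i).XB) → ℝ) (α : ℝ) (z : PBond (PV d ℓ i.m i.K hd hL) 0 → ℝ) :
    (GpU i).h1 (Sum.inl f) α (Sum.inr z) = 0 := rfl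

/-- … on a bond argument it is `0` for every cut-off. [cite: Balaban1984PropagatorsII, Prop. 2.2 (2.67) p.234 (the reading; bookkeeping)] -/
theorem GpU_h1_inr (J : PBond (PV d ℓ i.m i.K hd hL) 0 → ℝ) (α : ℝ) (ζ : KCut i) : (GpU i).h1 (Sum.inr J) α ζ = 0 := by
  cases ζ <;> rfl

/-- NODE 00's reading of the (3.48)∕(2.86) kernel `(Q′G′²Q′*)⁻¹` is p21's print-unit kernel `CinvTP` at the carrier blocks of the two
index bonds (`rfl`). [cite: Balaban1984PropagatorsII, Prop. 2.3 (2.86)–(2.87) p.238 (the reading)] -/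
theorem CinvU_ker_eq (b b' : (kGeoU i).Site) :
    (CinvU i).ker b b' = (CinvTP (toKT i)).ker (β i.hN i.D i.hk b) (β i.hN i.D i.hk b') := rfl

/-- NODE 00's sup entries are `≥ 0` on every argument (site summand: `gpTP_e_nonneg`; bond summand: `0`).
[cite: Balaban1984PropagatorsII, Prop. 2.2 (2.67) p.234 (bookkeeping)] -/
theorem GpU_e_nonneg (n : Fin 4) (lam : KLoc i) (b : (kGeoU i).Site) : 0 ≤ (GpU i).e n lam b := by
  cases lam with
  | inl f => exact gpTP_e_nonneg (toKT i) n f _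
  | inr J => exact le_rfl

/-- NODE 00's Hölder slot is `≥ 0` on every (argument, cut-off). [cite: Balaban1984PropagatorsII, Prop. 2.2 (2.67) p.234 (bookkeeping)] -/
theorem GpU_h1_nonneg (lam : KLoc i) (α : ℝ) (ζ : KCut i) : 0 ≤ (GpU i).h1 lam α ζ := by
  cases lam with
  | inl f =>
      cases ζ with
      | inl z => exact hHTP_nonneg (toKT i) f α z
      | inr z => exact le_rfl
  | inr J => cases ζ <;> exact le_rfl

end NodeReading

/-! ## §2 At one member: what the three comparisons say, summand by summand -/

section Member

variable (i : KIdx d ℓ hd hL b₀ b₁) {B : B9.Backgrounds} (Gp : B9.KernelFamily (geo9K i) B) (C : B9.SiteKernel (geo9K i) B)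

/-- **ROW `hGp_e` ⟺ ON ∧ OFF.**  The `U = 1` comparison of the four (3.42) sup entries of a [B9] kernel family `Gp` (the reading of `G′(U)`)
against NODE 00's `GpU` holds iff: ON the site summand each entry of `G′(1)` is below p21's print-unit (2.67) entry of [4]'s `Δ′_a⁻¹` at the
carrier block, and OFF it (bond arguments) each entry is `≤ 0`.  ANY backgrounds carrier, ANY kernel family.
[cite: Balaban1985BackgroundPropagators, Cor. 3.5 p.407 + (3.42) p.397; Balaban1984PropagatorsII, Prop. 2.2 (2.67) p.234] -/
theorem gp_e_le_GpU_iff :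
    (∀ (n : Fin 4) (lam : (geo9K i).Loc) (y : (geo9K i).Site), Gp.e n B.one lam y ≤ (GpU i).e n lam y) ↔
      (∀ (n : Fin 4) (f : ↥((toKT i).XB) → ℝ) (y : (geo9K i).Site),
          Gp.e n B.one (Sum.inl f) y ≤ (gpTP (toKT i)).e n f (β i.hN i.D i.hk y)) ∧
      (∀ (n : Fin 4) (J : PBond (PV d ℓ i.m i.K hd hL) 0 → ℝ) (y : (geo9K i).Site), Gp.e n B.one (Sum.inr J) y ≤ 0) :=
  ⟨fun h => ⟨fun n f y => h n (Sum.inl f) y, fun n J y => h n (Sum.inr J) y⟩, fun h n lam y => by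
    cases lam with
    | inl f => exact h.1 n f y
    | inr J => exact h.2 n J y⟩

/-- **ROW `hGp_h1` ⟺ ON ∧ three OFF nulls.**  The `U = 1` comparison of the (3.43) Hölder slot of `Gp` against `GpU` holds iff: on
(site argument, site cut-off) the slot of `G′(1)` is below p21's `hHTP` of [4]'s `Δ′_a⁻¹`, and it is `≤ 0` on (site argument, bond
cut-off) and on every bond argument. [cite: Balaban1985BackgroundPropagators, Cor. 3.5 p.407 + (3.43) p.398; Balaban1984PropagatorsII, Prop. 2.2 (2.67) p.234 (entries 4, 5)] -/
theorem gp_h1_le_GpU_iff :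
    (∀ (lam : (geo9K i).Loc) (b : ℝ) (ζ : (geo9K i).Cut), Gp.h1 B.one lam b ζ ≤ (GpU i).h1 lam b ζ) ↔
      (∀ (f : ↥((toKT i).XB) → ℝ) (b : ℝ) (z : ↥((toKT i).XB) → ℝ), Gp.h1 B.one (Sum.inl f) b (Sum.inl z) ≤ hHTP (toKT i) f b z) ∧
      (∀ (f : ↥((toKT i).XB) → ℝ) (b : ℝ) (z : PBond (PV d ℓ i.m i.K hd hL) 0 → ℝ), Gp.h1 B.one (Sum.inl f) b (Sum.inr z) ≤ 0) ∧
      (∀ (J : PBond (PV d ℓ i.m i.K hd hL) 0 → ℝ) (b : ℝ) (ζ : (geo9K i).Cut), Gp.h1 B.one (Sum.inr J) b ζ ≤ 0) :=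
  ⟨fun h => ⟨fun f b z => h (Sum.inl f) b (Sum.inl z), fun f b z => h (Sum.inl f) b (Sum.inr z),
      fun J b ζ => (h (Sum.inr J) b ζ).trans_eq (GpU_h1_inr i J b ζ)⟩,
    fun h lam b ζ => by
      cases lam with
      | inl f =>
          cases ζ with
          | inl z => exact h.1 f b z
          | inr z => exact h.2.1 f b z
      | inr J => exact (h.2.2 J b ζ).trans_eq (GpU_h1_inr i J b ζ).symm⟩

/-- **ROW `hC` UNFOLDED**: the `U = 1` comparison of the (3.48) kernel of `C` against `CinvU` is the comparison against p21's `CinvTP` of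
[4]'s `(Q′G′²Q′*)⁻¹` at the carrier blocks (`Iff.rfl`). [cite: Balaban1985BackgroundPropagators, Cor. 3.5 p.407 + Thm 3.2 (3.48) p.398; Balaban1984PropagatorsII, Prop. 2.3 (2.86)–(2.87) p.238] -/
theorem c_abs_le_CinvU_iff :
    (∀ y y' : (geo9K i).Site, |C.ker B.one y y'| ≤ |(CinvU i).ker y y'|) ↔
      ∀ y y' : (geo9K i).Site, |C.ker B.one y y'| ≤ |(CinvTP (toKT i)).ker (β i.hN i.D i.hk y) (β i.hN i.D i.hk y')| :=
  Iff.rfl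

/-- **ROW `hGp_e` FROM «G′(1) READ AS [4]'s Δ′_a⁻¹»**: equality with p21's entries ON the site summand and the null reading OFF it give
the comparison (with equality ON). [cite: Balaban1985BackgroundPropagators, Cor. 3.5 p.407 («for U = 1 … proved in [4]»); Balaban1984PropagatorsII, Prop. 2.2 (2.67) p.234] -/
theorem gp_e_le_GpU_of_eq_of_null
    (hon : ∀ (n : Fin 4) (f : ↥((toKT i).XB) → ℝ) (y : (geo9K i).Site),
      Gp.e n B.one (Sum.inl f) y = (gpTP (toKT i)).e n f (β i.hN i.D i.hk y))
    (hoff : ∀ (n : Fin 4) (J : PBond (PV d ℓ i.m i.K hd hL) 0 → ℝ) (y : (geo9K i).Site), Gp.e n B.one (Sum.inr J) y = 0) :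
    ∀ (n : Fin 4) (lam : (geo9K i).Loc) (y : (geo9K i).Site), Gp.e n B.one lam y ≤ (GpU i).e n lam y :=
  (gp_e_le_GpU_iff i Gp).2 ⟨fun n f y => (hon n f y).le, fun n J y => (hoff n J y).le⟩

/-- Row `hGp_e` from the ON inequality and the OFF null (inequality form of `gp_e_le_GpU_of_eq_of_null`).
[cite: Balaban1985BackgroundPropagators, Cor. 3.5 p.407; Balaban1984PropagatorsII, Prop. 2.2 (2.67) p.234] -/
theorem gp_e_le_GpU_of_on_off
    (hon : ∀ (n : Fin 4) (f : ↥((toKT i).XB) → ℝ) (y : (geo9K i).Site),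
      Gp.e n B.one (Sum.inl f) y ≤ (gpTP (toKT i)).e n f (β i.hN i.D i.hk y))
    (hoff : ∀ (n : Fin 4) (J : PBond (PV d ℓ i.m i.K hd hL) 0 → ℝ) (y : (geo9K i).Site), Gp.e n B.one (Sum.inr J) y ≤ 0) :
    ∀ (n : Fin 4) (lam : (geo9K i).Loc) (y : (geo9K i).Site), Gp.e n B.one lam y ≤ (GpU i).e n lam y :=
  (gp_e_le_GpU_iff i Gp).2 ⟨hon, hoff⟩

/-- **ROW `hGp_h1` FROM «G′(1) READ AS [4]'s Δ′_a⁻¹»**: equality with p21's Hölder slot on (site argument, site cut-off) and the null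
readings elsewhere give the comparison. [cite: Balaban1985BackgroundPropagators, Cor. 3.5 p.407 + (3.43) p.398; Balaban1984PropagatorsII, Prop. 2.2 (2.67) p.234] -/
theorem gp_h1_le_GpU_of_eq_of_null
    (hon : ∀ (f : ↥((toKT i).XB) → ℝ) (b : ℝ) (z : ↥((toKT i).XB) → ℝ), Gp.h1 B.one (Sum.inl f) b (Sum.inl z) = hHTP (toKT i) f b z)
    (hoffc : ∀ (f : ↥((toKT i).XB) → ℝ) (b : ℝ) (z : PBond (PV d ℓ i.m i.K hd hL) 0 → ℝ), Gp.h1 B.one (Sum.inl f) b (Sum.inr z) = 0)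
    (hoff : ∀ (J : PBond (PV d ℓ i.m i.K hd hL) 0 → ℝ) (b : ℝ) (ζ : (geo9K i).Cut), Gp.h1 B.one (Sum.inr J) b ζ = 0) :
    ∀ (lam : (geo9K i).Loc) (b : ℝ) (ζ : (geo9K i).Cut), Gp.h1 B.one lam b ζ ≤ (GpU i).h1 lam b ζ :=
  (gp_h1_le_GpU_iff i Gp).2 ⟨fun f b z => (hon f b z).le, fun f b z => (hoffc f b z).le, fun J b ζ => (hoff J b ζ).le⟩

/-- Row `hGp_h1` from the ON inequality and the OFF nulls (inequality form).
[cite: Balaban1985BackgroundPropagators, Cor. 3.5 p.407 + (3.43) p.398; Balaban1984PropagatorsII, Prop. 2.2 (2.67) p.234] -/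
theorem gp_h1_le_GpU_of_on_off
    (hon : ∀ (f : ↥((toKT i).XB) → ℝ) (b : ℝ) (z : ↥((toKT i).XB) → ℝ), Gp.h1 B.one (Sum.inl f) b (Sum.inl z) ≤ hHTP (toKT i) f b z)
    (hoffc : ∀ (f : ↥((toKT i).XB) → ℝ) (b : ℝ) (z : PBond (PV d ℓ i.m i.K hd hL) 0 → ℝ), Gp.h1 B.one (Sum.inl f) b (Sum.inr z) ≤ 0)
    (hoff : ∀ (J : PBond (PV d ℓ i.m i.K hd hL) 0 → ℝ) (b : ℝ) (ζ : (geo9K i).Cut), Gp.h1 B.one (Sum.inr J) b ζ ≤ 0) :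
    ∀ (lam : (geo9K i).Loc) (b : ℝ) (ζ : (geo9K i).Cut), Gp.h1 B.one lam b ζ ≤ (GpU i).h1 lam b ζ :=
  (gp_h1_le_GpU_iff i Gp).2 ⟨hon, hoffc, hoff⟩

/-- **ROW `hC` FROM «C(1) READ AS [4]'s (Q′G′²Q′*)⁻¹»**: pointwise equality of the (3.48) kernel at `U = 1` with NODE 00's reading gives the
comparison (with equality). [cite: Balaban1985BackgroundPropagators, Cor. 3.5 p.407 + Thm 3.2 (3.48) p.398; Balaban1984PropagatorsII, Prop. 2.3 (2.86)–(2.87) p.238] -/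
theorem c_abs_le_CinvU_of_eq (h : ∀ y y' : (geo9K i).Site, C.ker B.one y y' = (CinvU i).ker y y') :
    ∀ y y' : (geo9K i).Site, |C.ker B.one y y'| ≤ |(CinvU i).ker y y'| :=
  fun y y' => (congrArg abs (h y y')).le

/-- … the same with NODE 00's reading unfolded to p21's `CinvTP` at the carrier blocks.
[cite: Balaban1985BackgroundPropagators, Cor. 3.5 p.407 + Thm 3.2 (3.48) p.398; Balaban1984PropagatorsII, Prop. 2.3 (2.86)–(2.87) p.238] -/
theorem c_abs_le_CinvU_of_eq_T8
    (h : ∀ y y' : (geo9K i).Site, C.ker B.one y y' = (CinvTP (toKT i)).ker (β i.hN i.D i.hk y) (β i.hN i.D i.hk y')) :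
    ∀ y y' : (geo9K i).Site, |C.ker B.one y y'| ≤ |(CinvU i).ker y y'| :=
  c_abs_le_CinvU_of_eq i C h

/-- **NECESSITY (located): row `hGp_e` forces NULL bond-summand readings of `G′(1)`** — NODE 00 reads [4]'s `Δ′_a⁻¹` only on site
arguments (entry «G′∇*λ» included), so an operator layer meeting the comparison reads every (3.42) entry of `G′(1)` as `≤ 0` on bond
arguments. [cite: Balaban1985BackgroundPropagators, Cor. 3.5 p.407 + (3.42) p.397; Balaban1984PropagatorsII, Prop. 2.2 (2.67) p.234 (the reading)] -/
theorem gp_e_nonpos_of_le_GpU_of_isRight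
    (h : ∀ (n : Fin 4) (lam : (geo9K i).Loc) (y : (geo9K i).Site), Gp.e n B.one lam y ≤ (GpU i).e n lam y)
    (n : Fin 4) {lam : (geo9K i).Loc} (hr : lam.isRight = true) (y : (geo9K i).Site) : Gp.e n B.one lam y ≤ 0 :=
  (h n lam y).trans_eq (GpU_e_of_isRight i n hr y)

/-- **NECESSITY (located): row `hGp_h1` forces a NULL Hölder slot of `G′(1)` on bond arguments** (every cut-off).
[cite: Balaban1985BackgroundPropagators, Cor. 3.5 p.407 + (3.43) p.398; Balaban1984PropagatorsII, Prop. 2.2 (2.67) p.234 (the reading)] -/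
theorem gp_h1_nonpos_of_le_GpU_of_isRight
    (h : ∀ (lam : (geo9K i).Loc) (b : ℝ) (ζ : (geo9K i).Cut), Gp.h1 B.one lam b ζ ≤ (GpU i).h1 lam b ζ)
    {lam : (geo9K i).Loc} (hr : lam.isRight = true) (b : ℝ) (ζ : (geo9K i).Cut) : Gp.h1 B.one lam b ζ ≤ 0 := by
  cases lam with
  | inl f => exact absurd hr (by simp)
  | inr J => exact (h (Sum.inr J) b ζ).trans_eq (GpU_h1_inr i J b ζ)

/-- **NECESSITY (located): row `hGp_h1` forces a NULL Hölder slot of `G′(1)` on bond CUT-OFFS** (every argument) — NODE 00 reads the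
(2.67)₄,₅ cut-off `ζ` as a site function. [cite: Balaban1985BackgroundPropagators, Cor. 3.5 p.407 + (3.43) p.398; Balaban1984PropagatorsII, Prop. 2.2 (2.67) p.234 (the reading)] -/
theorem gp_h1_nonpos_of_le_GpU_of_cut_isRight
    (h : ∀ (lam : (geo9K i).Loc) (b : ℝ) (ζ : (geo9K i).Cut), Gp.h1 B.one lam b ζ ≤ (GpU i).h1 lam b ζ)
    (lam : (geo9K i).Loc) (b : ℝ) {ζ : (geo9K i).Cut} (hr : ζ.isRight = true) : Gp.h1 B.one lam b ζ ≤ 0 := by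
  cases ζ with
  | inl z => exact absurd hr (by simp)
  | inr z =>
      cases lam with
      | inl f => exact (h (Sum.inl f) b (Sum.inr z)).trans_eq (GpU_h1_inl_inr i f b z)
      | inr J => exact (h (Sum.inr J) b (Sum.inr z)).trans_eq (GpU_h1_inr i J b (Sum.inr z))

end Member

/-! ## §3 The co-reading route: Cor. 3.5 at `U = 1` in the currency of the knit chain of record -/

section CoReading

variable (i : KIdx d ℓ hd hL b₀ b₁) {B : B9.Backgrounds} (Gp : B9.KernelFamily (geo9K i) B)

/-- ★ **ROW `hGp_e`, ENTRY `n`, FROM A CO-READING AT `U = 1` DOMINATED BY [4]'s ENTRY.**  Suppose the `n`-th (3.42) quantity of `Gp` at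
`U = 1` is CO-REALIZED (`B9Thm37GlueCor36.CoRealizes`: it is below every nonnegative common bound of `|(A(ev λ))(x)|` over the block of
`y`) by a model operator `A` between real function lattices `v → u` with block maps `bu`, `bv` and argument evaluation `ev` — the shape
in which the knit chain of record reads `(ops x).Gp` (`Summit.…N06AtRecord11ObligationsW38`, hypotheses `hco_n`, here at `U = 1`).  If
the model operator at `U = 1` is DOMINATED, pointwise along the block map, by p21's print-unit entry of [4]'s `Δ′_a⁻¹` on the evaluated
site profile — Cor. 3.5: *"For operators with the external gauge field configuration U = 1, these theorems are proved in [4]"* — and the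
evaluation kills bond arguments, then the `n`-th clause of the comparison `hGp_e` holds.  Nothing asserted: the co-reading, the
domination and the null evaluation are hypotheses of printed shape on the (unconstructed) operator layer.
[cite: Balaban1985BackgroundPropagators, Cor. 3.5 p.407 + (3.39)∕(3.42) p.397; Balaban1984PropagatorsII, Prop. 2.2 (2.67) p.234] -/
theorem gp_e_le_GpU_of_coRealizes_one {u v : Type} (n : Fin 4) {bu : u → (geo9K i).Site} {bv : v → (geo9K i).Site}
    {ev : (geo9K i).Loc → v → ℝ} {A : (v → ℝ) →ₗ[ℝ] (u → ℝ)} (hco : CoRealizes Gp n B.one bu bv ev A)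
    (hdom : ∀ (f : ↥((toKT i).XB) → ℝ) (x : u), |A (ev (Sum.inl f)) x| ≤ (gpTP (toKT i)).e n f (β i.hN i.D i.hk (bu x)))
    (hoff : ∀ J : PBond (PV d ℓ i.m i.K hd hL) 0 → ℝ, ev (Sum.inr J) = 0)
    (lam : (geo9K i).Loc) (y : (geo9K i).Site) : Gp.e n B.one lam y ≤ (GpU i).e n lam y := by
  cases lam with
  | inl f =>
      refine hco.obs (Sum.inl f) y _ (GpU_e_nonneg i n (Sum.inl f) y) fun x hx => ?_
      rw [GpU_e_inl, ← hx]
      exact hdom f x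
  | inr J =>
      refine hco.obs (Sum.inr J) y 0 le_rfl fun x _ => ?_
      rw [hoff J, map_zero, Pi.zero_apply, abs_zero]

/-- **ROW `hGp_e`, ALL FOUR ENTRIES, OVER AN `Ops` RECORD AT `U = 1`** — the co-readings are LITERALLY the `hco0 … hco3` of the knit chain of
record specialised to `U = 1` (model operators `𝔬.Gp 1`, `𝔬.D 1 ∘ 𝔬.Gp 1`, `𝔬.Gp 1 ∘ 𝔬.Dstar 1`, `𝔬.Lap 1 ∘ 𝔬.Gp 1` of n06-c's letters
`B9Thm37Whole.Ops`; site evaluation `ev`, bond evaluation `evY`), the dominations say that at `U = 1` these four act — on the evaluated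
site profile, pointwise below p21's block suprema — as [4]'s `G′`, `∇G′`, `G′∇*`, `ΔG′` (Cor. 3.5), and both evaluations kill bond
arguments. [cite: Balaban1985BackgroundPropagators, Cor. 3.5 p.407 + (3.42) p.397 + (3.90) p.409 (the letters); Balaban1984PropagatorsII, Prop. 2.2 (2.67) p.234] -/
theorem gp_e_le_GpU_of_coRealizes_ops_one {X Y ι : Type}
    (𝔬 : Ops (geo9K i) B X Y ι) (ev : (geo9K i).Loc → X → ℝ) (evY : (geo9K i).Loc → Y → ℝ)
    (hco0 : CoRealizes Gp 0 B.one 𝔬.blk 𝔬.blk ev (𝔬.Gp B.one))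
    (hco1 : CoRealizes Gp 1 B.one 𝔬.blkY 𝔬.blk ev (𝔬.D B.one ∘ₗ 𝔬.Gp B.one))
    (hco2 : CoRealizes Gp 2 B.one 𝔬.blk 𝔬.blkY evY (𝔬.Gp B.one ∘ₗ 𝔬.Dstar B.one))
    (hco3 : CoRealizes Gp 3 B.one 𝔬.blk 𝔬.blk ev (𝔬.Lap B.one ∘ₗ 𝔬.Gp B.one))
    (hdom0 : ∀ (f : ↥((toKT i).XB) → ℝ) (x : X), |(𝔬.Gp B.one (ev (Sum.inl f))) x| ≤ (gpTP (toKT i)).e 0 f (β i.hN i.D i.hk (𝔬.blk x)))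
    (hdom1 : ∀ (f : ↥((toKT i).XB) → ℝ) (b : Y),
      |((𝔬.D B.one ∘ₗ 𝔬.Gp B.one) (ev (Sum.inl f))) b| ≤ (gpTP (toKT i)).e 1 f (β i.hN i.D i.hk (𝔬.blkY b)))
    (hdom2 : ∀ (f : ↥((toKT i).XB) → ℝ) (x : X),
      |((𝔬.Gp B.one ∘ₗ 𝔬.Dstar B.one) (evY (Sum.inl f))) x| ≤ (gpTP (toKT i)).e 2 f (β i.hN i.D i.hk (𝔬.blk x)))
    (hdom3 : ∀ (f : ↥((toKT i).XB) → ℝ) (x : X),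
      |((𝔬.Lap B.one ∘ₗ 𝔬.Gp B.one) (ev (Sum.inl f))) x| ≤ (gpTP (toKT i)).e 3 f (β i.hN i.D i.hk (𝔬.blk x)))
    (hoff : ∀ J : PBond (PV d ℓ i.m i.K hd hL) 0 → ℝ, ev (Sum.inr J) = 0)
    (hoffY : ∀ J : PBond (PV d ℓ i.m i.K hd hL) 0 → ℝ, evY (Sum.inr J) = 0) :
    ∀ (n : Fin 4) (lam : (geo9K i).Loc) (y : (geo9K i).Site), Gp.e n B.one lam y ≤ (GpU i).e n lam y := by
  intro n
  fin_cases n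
  · exact gp_e_le_GpU_of_coRealizes_one i Gp 0 hco0 hdom0 hoff
  · exact gp_e_le_GpU_of_coRealizes_one i Gp 1 hco1 hdom1 hoff
  · exact gp_e_le_GpU_of_coRealizes_one i Gp 2 hco2 hdom2 hoffY
  · exact gp_e_le_GpU_of_coRealizes_one i Gp 3 hco3 hdom3 hoff

end CoReading

/-! ## §4 Family level over def-Y's operator-layer signature: the knit binders `hGp_e`, `hGp_h1`, `hC` -/

section Family

variable {𝔸 : Type} [NormedRing 𝔸] [NormedAlgebra ℂ 𝔸] [CompleteSpace 𝔸] {G : Subgroup 𝔸ˣ}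
variable (ops : ∀ x : MemberY d ℓ hd hL b₀ b₁ Mstar, OperatorLayerY d ℓ hd hL b₀ b₁ Mstar 𝔸 G x)

/-- ★ **THE KNIT BINDER `hGp_e` FROM «G′(1) READ AS [4]'s Δ′_a⁻¹» AT EVERY MEMBER** — for EVERY operator layer `ops` over def-Y's signature
(at NODE 00's `OpsY N θ₃ M⋆`: `𝔸 = M_N(ℂ)`, `G = SU(N)`): if at every member the four (3.42) sup entries of `(ops x).Gp` at `U = 1` EQUAL p21's
print-unit (2.67) entries of [4]'s `Δ′_a⁻¹` at the carrier block on site arguments and VANISH on bond arguments, then the binder `hGp_e` of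
`B9PinCarriersKLevelV1.b9LeafX_carriersY` ∕ `Summit.…b9_main_of_up_view₁₁B10YZW_of_obligations` holds, LITERALLY.
[cite: Balaban1985BackgroundPropagators, Cor. 3.5 p.407 + (3.42) p.397; Balaban1984PropagatorsII, Prop. 2.2 (2.67) p.234] -/
theorem hGp_e_of_eq_of_null
    (hon : ∀ (x : MemberY d ℓ hd hL b₀ b₁ Mstar) (n : Fin 4) (f : ↥((toKT x.toKIdx).XB) → ℝ) (y : (geo9Y x).Site),
      (ops x).Gp.e n (bg9Y 𝔸 G x).one (Sum.inl f) y = (gpTP (toKT x.toKIdx)).e n f (β x.hN x.D x.hk y))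
    (hoff : ∀ (x : MemberY d ℓ hd hL b₀ b₁ Mstar) (n : Fin 4) (J : PBond (PV d ℓ x.m x.K hd hL) 0 → ℝ) (y : (geo9Y x).Site),
      (ops x).Gp.e n (bg9Y 𝔸 G x).one (Sum.inr J) y = 0) :
    ∀ (x : MemberY d ℓ hd hL b₀ b₁ Mstar) (n : Fin 4) (lam : (geo9Y x).Loc) (y : (geo9Y x).Site),
      (ops x).Gp.e n (bg9Y 𝔸 G x).one lam y ≤ (Node00.GpU x.toKIdx).e n lam y :=
  fun x => gp_e_le_GpU_of_eq_of_null x.toKIdx (ops x).Gp (hon x) (hoff x)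

/-- The binder `hGp_e` from the ON inequalities and the OFF nulls at every member (inequality form).
[cite: Balaban1985BackgroundPropagators, Cor. 3.5 p.407 + (3.42) p.397; Balaban1984PropagatorsII, Prop. 2.2 (2.67) p.234] -/
theorem hGp_e_of_on_off
    (hon : ∀ (x : MemberY d ℓ hd hL b₀ b₁ Mstar) (n : Fin 4) (f : ↥((toKT x.toKIdx).XB) → ℝ) (y : (geo9Y x).Site),
      (ops x).Gp.e n (bg9Y 𝔸 G x).one (Sum.inl f) y ≤ (gpTP (toKT x.toKIdx)).e n f (β x.hN x.D x.hk y))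
    (hoff : ∀ (x : MemberY d ℓ hd hL b₀ b₁ Mstar) (n : Fin 4) (J : PBond (PV d ℓ x.m x.K hd hL) 0 → ℝ) (y : (geo9Y x).Site),
      (ops x).Gp.e n (bg9Y 𝔸 G x).one (Sum.inr J) y ≤ 0) :
    ∀ (x : MemberY d ℓ hd hL b₀ b₁ Mstar) (n : Fin 4) (lam : (geo9Y x).Loc) (y : (geo9Y x).Site),
      (ops x).Gp.e n (bg9Y 𝔸 G x).one lam y ≤ (Node00.GpU x.toKIdx).e n lam y :=
  fun x => gp_e_le_GpU_of_on_off x.toKIdx (ops x).Gp (hon x) (hoff x)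

/-- ★ **THE KNIT BINDER `hGp_h1` FROM «G′(1) READ AS [4]'s Δ′_a⁻¹» AT EVERY MEMBER**: if at every member the (3.43) Hölder slot of
`(ops x).Gp` at `U = 1` EQUALS p21's `hHTP` of [4]'s `Δ′_a⁻¹` on (site argument, site cut-off) and VANISHES on bond cut-offs and on bond
arguments, then the binder `hGp_h1` holds, LITERALLY. [cite: Balaban1985BackgroundPropagators, Cor. 3.5 p.407 + (3.43) p.398; Balaban1984PropagatorsII, Prop. 2.2 (2.67) p.234 (entries 4, 5)] -/
theorem hGp_h1_of_eq_of_null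
    (hon : ∀ (x : MemberY d ℓ hd hL b₀ b₁ Mstar) (f : ↥((toKT x.toKIdx).XB) → ℝ) (b : ℝ) (z : ↥((toKT x.toKIdx).XB) → ℝ),
      (ops x).Gp.h1 (bg9Y 𝔸 G x).one (Sum.inl f) b (Sum.inl z) = hHTP (toKT x.toKIdx) f b z)
    (hoffc : ∀ (x : MemberY d ℓ hd hL b₀ b₁ Mstar) (f : ↥((toKT x.toKIdx).XB) → ℝ) (b : ℝ) (z : PBond (PV d ℓ x.m x.K hd hL) 0 → ℝ),
      (ops x).Gp.h1 (bg9Y 𝔸 G x).one (Sum.inl f) b (Sum.inr z) = 0)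
    (hoff : ∀ (x : MemberY d ℓ hd hL b₀ b₁ Mstar) (J : PBond (PV d ℓ x.m x.K hd hL) 0 → ℝ) (b : ℝ) (ζ : (geo9Y x).Cut),
      (ops x).Gp.h1 (bg9Y 𝔸 G x).one (Sum.inr J) b ζ = 0) :
    ∀ (x : MemberY d ℓ hd hL b₀ b₁ Mstar) (lam : (geo9Y x).Loc) (b : ℝ) (ζ : (geo9Y x).Cut),
      (ops x).Gp.h1 (bg9Y 𝔸 G x).one lam b ζ ≤ (Node00.GpU x.toKIdx).h1 lam b ζ :=
  fun x => gp_h1_le_GpU_of_eq_of_null x.toKIdx (ops x).Gp (hon x) (hoffc x) (hoff x)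

/-- The binder `hGp_h1` from the ON inequality and the OFF nulls at every member (inequality form).
[cite: Balaban1985BackgroundPropagators, Cor. 3.5 p.407 + (3.43) p.398; Balaban1984PropagatorsII, Prop. 2.2 (2.67) p.234 (entries 4, 5)] -/
theorem hGp_h1_of_on_off
    (hon : ∀ (x : MemberY d ℓ hd hL b₀ b₁ Mstar) (f : ↥((toKT x.toKIdx).XB) → ℝ) (b : ℝ) (z : ↥((toKT x.toKIdx).XB) → ℝ),
      (ops x).Gp.h1 (bg9Y 𝔸 G x).one (Sum.inl f) b (Sum.inl z) ≤ hHTP (toKT x.toKIdx) f b z)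
    (hoffc : ∀ (x : MemberY d ℓ hd hL b₀ b₁ Mstar) (f : ↥((toKT x.toKIdx).XB) → ℝ) (b : ℝ) (z : PBond (PV d ℓ x.m x.K hd hL) 0 → ℝ),
      (ops x).Gp.h1 (bg9Y 𝔸 G x).one (Sum.inl f) b (Sum.inr z) ≤ 0)
    (hoff : ∀ (x : MemberY d ℓ hd hL b₀ b₁ Mstar) (J : PBond (PV d ℓ x.m x.K hd hL) 0 → ℝ) (b : ℝ) (ζ : (geo9Y x).Cut),
      (ops x).Gp.h1 (bg9Y 𝔸 G x).one (Sum.inr J) b ζ ≤ 0) :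
    ∀ (x : MemberY d ℓ hd hL b₀ b₁ Mstar) (lam : (geo9Y x).Loc) (b : ℝ) (ζ : (geo9Y x).Cut),
      (ops x).Gp.h1 (bg9Y 𝔸 G x).one lam b ζ ≤ (Node00.GpU x.toKIdx).h1 lam b ζ :=
  fun x => gp_h1_le_GpU_of_on_off x.toKIdx (ops x).Gp (hon x) (hoffc x) (hoff x)

/-- ★ **THE KNIT BINDER `hC` FROM «C(1) READ AS [4]'s (Q′G′²Q′*)⁻¹» AT EVERY MEMBER**: if at every member the (3.48) kernel of `(ops x).Cinv`
at `U = 1` EQUALS NODE 00's reading `Node00.CinvU`, then the binder `hC` holds (with equality), LITERALLY.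
[cite: Balaban1985BackgroundPropagators, Cor. 3.5 p.407 + Thm 3.2 (3.48) p.398; Balaban1984PropagatorsII, Prop. 2.3 (2.86)–(2.87) p.238] -/
theorem hC_of_eq
    (h : ∀ (x : MemberY d ℓ hd hL b₀ b₁ Mstar) (y y' : (geo9Y x).Site),
      (ops x).Cinv.ker (bg9Y 𝔸 G x).one y y' = (Node00.CinvU x.toKIdx).ker y y') :
    ∀ (x : MemberY d ℓ hd hL b₀ b₁ Mstar) (y y' : (geo9Y x).Site),
      |(ops x).Cinv.ker (bg9Y 𝔸 G x).one y y'| ≤ |(Node00.CinvU x.toKIdx).ker y y'| :=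
  fun x => c_abs_le_CinvU_of_eq x.toKIdx (ops x).Cinv (h x)

/-- The binder `hC` from pointwise equality with p21's `CinvTP` at the carrier blocks (NODE 00's reading unfolded).
[cite: Balaban1985BackgroundPropagators, Cor. 3.5 p.407 + Thm 3.2 (3.48) p.398; Balaban1984PropagatorsII, Prop. 2.3 (2.86)–(2.87) p.238] -/
theorem hC_of_eq_T8
    (h : ∀ (x : MemberY d ℓ hd hL b₀ b₁ Mstar) (y y' : (geo9Y x).Site),
      (ops x).Cinv.ker (bg9Y 𝔸 G x).one y y' = (CinvTP (toKT x.toKIdx)).ker (β x.hN x.D x.hk y) (β x.hN x.D x.hk y')) :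
    ∀ (x : MemberY d ℓ hd hL b₀ b₁ Mstar) (y y' : (geo9Y x).Site),
      |(ops x).Cinv.ker (bg9Y 𝔸 G x).one y y'| ≤ |(Node00.CinvU x.toKIdx).ker y y'| :=
  fun x => c_abs_le_CinvU_of_eq_T8 x.toKIdx (ops x).Cinv (h x)

/-- ★ **THE KNIT BINDER `hGp_e` FROM THE CO-READINGS OF THE KNIT CHAIN OF RECORD AT `U = 1`** — for EVERY operator layer `ops` over def-Y's
signature and EVERY family of `Ops` records `𝔬 x` (n06-c's letters) with site∕bond evaluations `ev x`, `evY x`: the four co-readings of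
`(ops x).Gp` at `U = 1` (the W38 chain's `hco0 … hco3` at `U = 1`), the four dominations at `U = 1` by p21's entries of [4]'s `Δ′_a⁻¹`
(Cor. 3.5) and the null evaluations of bond arguments give the binder `hGp_e`, LITERALLY.
[cite: Balaban1985BackgroundPropagators, Cor. 3.5 p.407 + (3.42) p.397 + (3.90) p.409; Balaban1984PropagatorsII, Prop. 2.2 (2.67) p.234] -/
theorem hGp_e_of_coRealizes_ops_one {X Y ι : MemberY d ℓ hd hL b₀ b₁ Mstar → Type}
    (𝔬 : ∀ x : MemberY d ℓ hd hL b₀ b₁ Mstar, Ops (geo9Y x) (bg9Y 𝔸 G x) (X x) (Y x) (ι x))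
    (ev : ∀ x : MemberY d ℓ hd hL b₀ b₁ Mstar, (geo9Y x).Loc → X x → ℝ)
    (evY : ∀ x : MemberY d ℓ hd hL b₀ b₁ Mstar, (geo9Y x).Loc → Y x → ℝ)
    (hco0 : ∀ x, CoRealizes (ops x).Gp 0 (bg9Y 𝔸 G x).one (𝔬 x).blk (𝔬 x).blk (ev x) ((𝔬 x).Gp (bg9Y 𝔸 G x).one))
    (hco1 : ∀ x, CoRealizes (ops x).Gp 1 (bg9Y 𝔸 G x).one (𝔬 x).blkY (𝔬 x).blk (ev x)
      ((𝔬 x).D (bg9Y 𝔸 G x).one ∘ₗ (𝔬 x).Gp (bg9Y 𝔸 G x).one))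
    (hco2 : ∀ x, CoRealizes (ops x).Gp 2 (bg9Y 𝔸 G x).one (𝔬 x).blk (𝔬 x).blkY (evY x)
      ((𝔬 x).Gp (bg9Y 𝔸 G x).one ∘ₗ (𝔬 x).Dstar (bg9Y 𝔸 G x).one))
    (hco3 : ∀ x, CoRealizes (ops x).Gp 3 (bg9Y 𝔸 G x).one (𝔬 x).blk (𝔬 x).blk (ev x)
      ((𝔬 x).Lap (bg9Y 𝔸 G x).one ∘ₗ (𝔬 x).Gp (bg9Y 𝔸 G x).one))
    (hdom0 : ∀ (x : MemberY d ℓ hd hL b₀ b₁ Mstar) (f : ↥((toKT x.toKIdx).XB) → ℝ) (z : X x),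
      |((𝔬 x).Gp (bg9Y 𝔸 G x).one (ev x (Sum.inl f))) z| ≤ (gpTP (toKT x.toKIdx)).e 0 f (β x.hN x.D x.hk ((𝔬 x).blk z)))
    (hdom1 : ∀ (x : MemberY d ℓ hd hL b₀ b₁ Mstar) (f : ↥((toKT x.toKIdx).XB) → ℝ) (b : Y x),
      |(((𝔬 x).D (bg9Y 𝔸 G x).one ∘ₗ (𝔬 x).Gp (bg9Y 𝔸 G x).one) (ev x (Sum.inl f))) b| ≤
        (gpTP (toKT x.toKIdx)).e 1 f (β x.hN x.D x.hk ((𝔬 x).blkY b)))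
    (hdom2 : ∀ (x : MemberY d ℓ hd hL b₀ b₁ Mstar) (f : ↥((toKT x.toKIdx).XB) → ℝ) (z : X x),
      |(((𝔬 x).Gp (bg9Y 𝔸 G x).one ∘ₗ (𝔬 x).Dstar (bg9Y 𝔸 G x).one) (evY x (Sum.inl f))) z| ≤
        (gpTP (toKT x.toKIdx)).e 2 f (β x.hN x.D x.hk ((𝔬 x).blk z)))
    (hdom3 : ∀ (x : MemberY d ℓ hd hL b₀ b₁ Mstar) (f : ↥((toKT x.toKIdx).XB) → ℝ) (z : X x),
      |(((𝔬 x).Lap (bg9Y 𝔸 G x).one ∘ₗ (𝔬 x).Gp (bg9Y 𝔸 G x).one) (ev x (Sum.inl f))) z| ≤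
        (gpTP (toKT x.toKIdx)).e 3 f (β x.hN x.D x.hk ((𝔬 x).blk z)))
    (hoff : ∀ (x : MemberY d ℓ hd hL b₀ b₁ Mstar) (J : PBond (PV d ℓ x.m x.K hd hL) 0 → ℝ), ev x (Sum.inr J) = 0)
    (hoffY : ∀ (x : MemberY d ℓ hd hL b₀ b₁ Mstar) (J : PBond (PV d ℓ x.m x.K hd hL) 0 → ℝ), evY x (Sum.inr J) = 0) :
    ∀ (x : MemberY d ℓ hd hL b₀ b₁ Mstar) (n : Fin 4) (lam : (geo9Y x).Loc) (y : (geo9Y x).Site),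
      (ops x).Gp.e n (bg9Y 𝔸 G x).one lam y ≤ (Node00.GpU x.toKIdx).e n lam y :=
  fun x => gp_e_le_GpU_of_coRealizes_ops_one x.toKIdx (ops x).Gp (𝔬 x) (ev x) (evY x) (hco0 x) (hco1 x) (hco2 x) (hco3 x)
    (hdom0 x) (hdom1 x) (hdom2 x) (hdom3 x) (hoff x) (hoffY x)

end Family

end Literature.MathematicalPhysics.QuantumFieldTheory.Balaban1983to89.B9Cor35ComparisonsGpC

end
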